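import Mathlib
import Summits.Ventures.PercRepro2.V2SP
import Summits.Ventures.PercRepro2.HallOffFrame
import Summits.Ventures.PercRepro2.HallOffAxis
import Summits.Ventures.PercRepro2.Tail2DCount
import Summits.Ventures.PercRepro2.Tail2DThreePoint
import Summits.Ventures.PercRepro2.Tail2DP2Series
import Summits.Ventures.PercRepro2.Tail2DDisjointPaths
import Summits.Ventures.PercRepro2.Tail2DP2SeriesSP
import Summits.Ventures.PercRepro2.Tail2DAxisUnimodal
import Summits.Ventures.PercRepro2.Tail2DOffAxis31
import Summits.Ventures.PercRepro2.Tail2DRowOne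
import Summits.Ventures.PercRepro2.Tail2DStepRowZero
import Summits.Ventures.PercRepro2.Tail2DStepCert
import Summits.Ventures.PercRepro2.Tail2DOffAxisCert
import Summits.Ventures.PercRepro2.Tail2DStepFour
import Summits.Ventures.PercRepro2.Tail2DStepFive
import Summits.Ventures.PercRepro2.Tail2DOffAxisSix
import Summits.Ventures.PercRepro2.Tail2DOffAxisSeven
import Summits.Ventures.PercRepro2.Tail2DOffAxisEight
import Summits.Ventures.PercRepro2.Tail2DOffAxisNine
import Summits.Ventures.PercRepro2.Tail2DColTwoCert
import Summits.Ventures.PercRepro2.Tail2DColTwo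
import Summits.Ventures.PercRepro2.Tail2DColThreeCertA
import Summits.Ventures.PercRepro2.Tail2DColThreeCertB
import Summits.Ventures.PercRepro2.Tail2DColThreeCertC
import Summits.Ventures.PercRepro2.Tail2DColThreeCertD

/-!
# The symbolic-`a` certificate of the column `j = 3` of the off-axis family: the pointwise lemma
(seat mine-b, cell pub-perc-repro2; MINE-B.md §38)

The weight `phi a 3 r b = [r+1 = a ∧ 4 ≤ b] − [a ≤ r ∧ b = 3]` of a PARALLEL composition (labels
`(r+r', b+b')`) dominates, for every `a ≥ 10`, a sum of 114 products written in coordinates RELATIVE to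
`a` (`phi_col3_par_ge` times 6): (cell of one factor) × (hypothesis weight of the other) and products of two
hypotheses — the hypotheses being the column itself at the levels `5 … a` (the induction hypothesis; the
middle block `5 ≤ r ≤ a−5` of one factor calls the level `a − r` of the other), the rows `j < 3` at
every level (theorems), count-zero weights (offset-one `phi (j+1) j`, swap differences `D/G/H`), and
possibly STEP weights.  The certificate was found by a linear programme over products of low and
`a`-relative weights and verified exactly for a range of `a`; the proof is a case analysis on the labels
(`b, b' ∈ {0, …, 5, ≥6}` and the 14 regimes of `r` and of `r'`) closed by `omega`.
-/

namespace Summit.Ventures.PercRepro2.Tail2D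

open V2Closure

section Pointwise

/-- **the pointwise certificate of the parallel step of the column `j = 3`** (`a ≥ 10`): the fibres assembled -/
theorem phi_col3_par_ge (a r b r' b' : ℕ) (ha : 10 ≤ a) :
      ((if b = 1 ∧ 6 ≤ r then (1 : ℤ) else 0) - (if r = 1 ∧ 6 ≤ b then (1 : ℤ) else 0)) * phi (a - 4) 2 r' b'
    + (2 : ℤ) * (((if b = 2 ∧ 6 ≤ r then (1 : ℤ) else 0) - (if r = 2 ∧ 6 ≤ b then (1 : ℤ) else 0)) * phi (a - 3) 1 r' b')
    + (2 : ℤ) * (((if b = 3 ∧ 6 ≤ r then (1 : ℤ) else 0) - (if r = 3 ∧ 6 ≤ b then (1 : ℤ) else 0)) * phi (a - 4) 0 r' b')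
    + (5 : ℤ) * (((if b = 0 ∧ 5 ≤ r then (1 : ℤ) else 0) - (if r = 0 ∧ 5 ≤ b then (1 : ℤ) else 0)) * ((if 2 ≤ r' ∧ 4 ≤ b' then (1 : ℤ) else 0) - (if 2 ≤ b' ∧ 4 ≤ r' then (1 : ℤ) else 0)))
    + (2 : ℤ) * (((if b = 2 ∧ 3 ≤ r then (1 : ℤ) else 0) - (if r = 2 ∧ 3 ≤ b then (1 : ℤ) else 0)) * phi (a - 3) 1 r' b')
    + (4 : ℤ) * ((if r' + 4 = a ∧ b' = 0 then (1 : ℤ) else 0) * ((if b = 2 ∧ 4 ≤ r then (1 : ℤ) else 0) - (if r = 2 ∧ 4 ≤ b then (1 : ℤ) else 0)))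
    + (4 : ℤ) * (((if 2 ≤ b ∧ 4 ≤ r then (1 : ℤ) else 0) - (if 2 ≤ r ∧ 4 ≤ b then (1 : ℤ) else 0)) * ((if r' = 0 ∧ 5 ≤ b' then (1 : ℤ) else 0) - (if b' = 0 ∧ 5 ≤ r' then (1 : ℤ) else 0)))
    + (4 : ℤ) * ((if 5 ≤ r' ∧ r' + 5 ≤ a ∧ b' = 0 then (1 : ℤ) else 0) * ((if 2 ≤ b ∧ 4 ≤ r then (1 : ℤ) else 0) - (if 2 ≤ r ∧ 4 ≤ b then (1 : ℤ) else 0)))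
    + (4 : ℤ) * ((if r' = 0 ∧ b' = 5 then (1 : ℤ) else 0) * ((if 2 ≤ r ∧ 4 ≤ b then (1 : ℤ) else 0) - (if 2 ≤ b ∧ 4 ≤ r then (1 : ℤ) else 0)))
    + (4 : ℤ) * ((if r' = 0 ∧ 6 ≤ b' then (1 : ℤ) else 0) * ((if 2 ≤ r ∧ 4 ≤ b then (1 : ℤ) else 0) - (if 2 ≤ b ∧ 4 ≤ r then (1 : ℤ) else 0)))
    + (6 : ℤ) * ((if 5 ≤ r ∧ r + 5 ≤ a ∧ b = 0 then (1 : ℤ) else 0) * phi (a - r) 3 r' b')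
    + (5 : ℤ) * ((if 5 ≤ r ∧ r + 5 ≤ a ∧ b = 1 then (1 : ℤ) else 0) * phi (a - r) 2 r' b')
    + (if 5 ≤ r ∧ r + 5 ≤ a ∧ b = 1 then (1 : ℤ) else 0) * phi (a - r + 1) 2 r' b'
    + (if 5 ≤ r ∧ r + 5 ≤ a ∧ b = 1 then (1 : ℤ) else 0) * phi (a - r) 3 r' b'
    + (4 : ℤ) * ((if 5 ≤ r ∧ r + 5 ≤ a ∧ b = 2 then (1 : ℤ) else 0) * phi (a - r) 1 r' b')
    + (if 5 ≤ r ∧ r + 5 ≤ a ∧ b = 2 then (1 : ℤ) else 0) * phi (a - r) 3 r' b'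
    + (2 : ℤ) * ((if 5 ≤ r ∧ r + 5 ≤ a ∧ b = 3 then (1 : ℤ) else 0) * phi (a - r + 1) 0 r' b')
    + (2 : ℤ) * ((if 5 ≤ r ∧ r + 5 ≤ a ∧ b = 3 then (1 : ℤ) else 0) * phi (a - r) 1 r' b')
    + (if 5 ≤ r ∧ r + 5 ≤ a ∧ b = 3 then (1 : ℤ) else 0) * phi (a - r) 3 r' b'
    + (2 : ℤ) * ((if 5 ≤ r ∧ r + 5 ≤ a ∧ b = 4 then (1 : ℤ) else 0) * phi (a - r) 1 r' b')
    + (if 5 ≤ r ∧ r + 5 ≤ a ∧ b = 4 then (1 : ℤ) else 0) * phi (a - r) 3 r' b'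
    + (2 : ℤ) * ((if 5 ≤ r ∧ r + 5 ≤ a ∧ b = 5 then (1 : ℤ) else 0) * phi (a - r) 1 r' b')
    + (if 5 ≤ r ∧ r + 5 ≤ a ∧ b = 5 then (1 : ℤ) else 0) * phi (a - r) 3 r' b'
    + (2 : ℤ) * ((if 5 ≤ r ∧ r + 5 ≤ a ∧ 6 ≤ b then (1 : ℤ) else 0) * phi (a - r) 1 r' b')
    + (if 5 ≤ r ∧ r + 5 ≤ a ∧ 6 ≤ b then (1 : ℤ) else 0) * phi (a - r) 3 r' b'
    + (6 : ℤ) * ((if 5 ≤ r' ∧ r' + 5 ≤ a ∧ b' = 0 then (1 : ℤ) else 0) * phi (a - r') 3 r b)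
    + (4 : ℤ) * ((if 5 ≤ r' ∧ r' + 5 ≤ a ∧ b' = 1 then (1 : ℤ) else 0) * phi (a - r') 2 r b)
    + (2 : ℤ) * ((if 5 ≤ r' ∧ r' + 5 ≤ a ∧ b' = 1 then (1 : ℤ) else 0) * phi (a - r' + 1) 2 r b)
    + (2 : ℤ) * ((if 5 ≤ r' ∧ r' + 5 ≤ a ∧ b' = 1 then (1 : ℤ) else 0) * phi (a - r') 3 r b)
    + (2 : ℤ) * ((if 5 ≤ r' ∧ r' + 5 ≤ a ∧ b' = 2 then (1 : ℤ) else 0) * phi (a - r') 1 r b)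
    + (2 : ℤ) * ((if 5 ≤ r' ∧ r' + 5 ≤ a ∧ b' = 2 then (1 : ℤ) else 0) * phi (a - r') 3 r b)
    + (if 5 ≤ r' ∧ r' + 5 ≤ a ∧ b' = 3 then (1 : ℤ) else 0) * phi (a - r' + 1) 0 r b
    + (if 5 ≤ r' ∧ r' + 5 ≤ a ∧ b' = 3 then (1 : ℤ) else 0) * phi (a - r') 1 r b
    + (2 : ℤ) * ((if 5 ≤ r' ∧ r' + 5 ≤ a ∧ b' = 3 then (1 : ℤ) else 0) * phi (a - r') 3 r b)
    + (if 5 ≤ r' ∧ r' + 5 ≤ a ∧ b' = 4 then (1 : ℤ) else 0) * phi (a - r') 1 r b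
    + (2 : ℤ) * ((if 5 ≤ r' ∧ r' + 5 ≤ a ∧ b' = 4 then (1 : ℤ) else 0) * phi (a - r') 3 r b)
    + (if 5 ≤ r' ∧ r' + 5 ≤ a ∧ b' = 5 then (1 : ℤ) else 0) * phi (a - r') 1 r b
    + (2 : ℤ) * ((if 5 ≤ r' ∧ r' + 5 ≤ a ∧ b' = 5 then (1 : ℤ) else 0) * phi (a - r') 3 r b)
    + (if 5 ≤ r' ∧ r' + 5 ≤ a ∧ 6 ≤ b' then (1 : ℤ) else 0) * phi (a - r') 1 r b
    + (2 : ℤ) * ((if 5 ≤ r' ∧ r' + 5 ≤ a ∧ 6 ≤ b' then (1 : ℤ) else 0) * phi (a - r') 3 r b)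
    + (6 : ℤ) * ((if r = 0 ∧ b = 0 then (1 : ℤ) else 0) * phi a 3 r' b')
    + (6 : ℤ) * ((if r = 0 ∧ b = 1 then (1 : ℤ) else 0) * phi a 2 r' b')
    + (6 : ℤ) * ((if r = 0 ∧ b = 2 then (1 : ℤ) else 0) * phi a 1 r' b')
    + (6 : ℤ) * ((if r = 0 ∧ b = 3 then (1 : ℤ) else 0) * phi a 0 r' b')
    + (5 : ℤ) * ((if r = 0 ∧ b = 5 then (1 : ℤ) else 0) * ((if 2 ≤ r' ∧ 4 ≤ b' then (1 : ℤ) else 0) - (if 2 ≤ b' ∧ 4 ≤ r' then (1 : ℤ) else 0)))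
    + (5 : ℤ) * ((if r = 0 ∧ 6 ≤ b then (1 : ℤ) else 0) * ((if 2 ≤ r' ∧ 4 ≤ b' then (1 : ℤ) else 0) - (if 2 ≤ b' ∧ 4 ≤ r' then (1 : ℤ) else 0)))
    + (6 : ℤ) * ((if r = 1 ∧ b = 0 then (1 : ℤ) else 0) * phi (a - 1) 3 r' b')
    + (6 : ℤ) * ((if r = 1 ∧ b = 1 then (1 : ℤ) else 0) * phi (a - 1) 2 r' b')
    + (6 : ℤ) * ((if r = 1 ∧ b = 2 then (1 : ℤ) else 0) * phi (a - 1) 1 r' b')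
    + (6 : ℤ) * ((if r = 1 ∧ b = 3 then (1 : ℤ) else 0) * phi (a - 1) 0 r' b')
    + (if r = 1 ∧ 6 ≤ b then (1 : ℤ) else 0) * phi (a - 4) 2 r' b'
    + (6 : ℤ) * ((if r = 2 ∧ b = 0 then (1 : ℤ) else 0) * phi (a - 2) 3 r' b')
    + (6 : ℤ) * ((if r = 2 ∧ b = 1 then (1 : ℤ) else 0) * phi (a - 2) 2 r' b')
    + (6 : ℤ) * ((if r = 2 ∧ b = 2 then (1 : ℤ) else 0) * phi (a - 2) 1 r' b')
    + (6 : ℤ) * ((if r = 2 ∧ b = 3 then (1 : ℤ) else 0) * phi (a - 2) 0 r' b')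
    + (2 : ℤ) * ((if r = 2 ∧ b = 3 then (1 : ℤ) else 0) * phi (a - 3) 1 r' b')
    + (4 : ℤ) * ((if r = 2 ∧ b = 4 then (1 : ℤ) else 0) * phi (a - 2) 0 r' b')
    + (2 : ℤ) * ((if r = 2 ∧ b = 4 then (1 : ℤ) else 0) * phi (a - 2) 1 r' b')
    + (4 : ℤ) * ((if r = 2 ∧ b = 5 then (1 : ℤ) else 0) * phi (a - 2) 0 r' b')
    + (2 : ℤ) * ((if r = 2 ∧ b = 5 then (1 : ℤ) else 0) * phi (a - 2) 1 r' b')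
    + (4 : ℤ) * ((if r = 2 ∧ 6 ≤ b then (1 : ℤ) else 0) * phi (a - 2) 0 r' b')
    + (2 : ℤ) * ((if r = 2 ∧ 6 ≤ b then (1 : ℤ) else 0) * phi (a - 2) 1 r' b')
    + (2 : ℤ) * ((if r = 2 ∧ 6 ≤ b then (1 : ℤ) else 0) * phi (a - 3) 1 r' b')
    + (6 : ℤ) * ((if r = 3 ∧ b = 0 then (1 : ℤ) else 0) * phi (a - 3) 3 r' b')
    + (6 : ℤ) * ((if r = 3 ∧ b = 1 then (1 : ℤ) else 0) * phi (a - 3) 2 r' b')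
    + (4 : ℤ) * ((if r = 3 ∧ b = 2 then (1 : ℤ) else 0) * phi (a - 3) 1 r' b')
    + (2 : ℤ) * ((if r = 3 ∧ b = 3 then (1 : ℤ) else 0) * phi (a - 3) 0 r' b')
    + (2 : ℤ) * ((if r = 3 ∧ 6 ≤ b then (1 : ℤ) else 0) * phi (a - 3) 0 r' b')
    + (6 : ℤ) * ((if r = 4 ∧ b = 0 then (1 : ℤ) else 0) * phi (a - 4) 3 r' b')
    + (6 : ℤ) * ((if r = 4 ∧ b = 1 then (1 : ℤ) else 0) * phi (a - 4) 2 r' b')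
    + (2 : ℤ) * ((if r = 4 ∧ b = 2 then (1 : ℤ) else 0) * phi (a - 3) 1 r' b')
    + (2 : ℤ) * ((if r = 4 ∧ b = 2 then (1 : ℤ) else 0) * phi (a - 4) 1 r' b')
    + (2 : ℤ) * ((if r = 4 ∧ b = 3 then (1 : ℤ) else 0) * phi (a - 4) 0 r' b')
    + (5 : ℤ) * ((if r + 4 = a ∧ b = 0 then (1 : ℤ) else 0) * ((if b' = 2 ∧ 4 ≤ r' then (1 : ℤ) else 0) - (if r' = 2 ∧ 4 ≤ b' then (1 : ℤ) else 0)))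
    + (5 : ℤ) * ((if 5 ≤ r ∧ r + 5 ≤ a ∧ b = 0 then (1 : ℤ) else 0) * ((if 2 ≤ b' ∧ 4 ≤ r' then (1 : ℤ) else 0) - (if 2 ≤ r' ∧ 4 ≤ b' then (1 : ℤ) else 0)))
    + (4 : ℤ) * (phi 4 2 r b * phi (a - 3) 0 r' b')
    + (6 : ℤ) * ((if r' = 0 ∧ b' = 3 then (1 : ℤ) else 0) * phi a 0 r b)
    + (6 : ℤ) * ((if r' = 0 ∧ b' = 2 then (1 : ℤ) else 0) * phi a 1 r b)
    + (6 : ℤ) * ((if r' = 0 ∧ b' = 1 then (1 : ℤ) else 0) * phi a 2 r b)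
    + (6 : ℤ) * ((if r' = 0 ∧ b' = 0 then (1 : ℤ) else 0) * phi a 3 r b)
    + (6 : ℤ) * ((if r' = 1 ∧ b' = 3 then (1 : ℤ) else 0) * phi (a - 1) 0 r b)
    + (6 : ℤ) * ((if r' = 1 ∧ b' = 2 then (1 : ℤ) else 0) * phi (a - 1) 1 r b)
    + (6 : ℤ) * ((if r' = 1 ∧ b' = 1 then (1 : ℤ) else 0) * phi (a - 1) 2 r b)
    + (6 : ℤ) * ((if r' = 1 ∧ b' = 0 then (1 : ℤ) else 0) * phi (a - 1) 3 r b)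
    + (6 : ℤ) * ((if r' = 2 ∧ b' = 3 then (1 : ℤ) else 0) * phi (a - 2) 0 r b)
    + (5 : ℤ) * ((if r' = 2 ∧ b' = 4 then (1 : ℤ) else 0) * phi (a - 2) 0 r b)
    + (5 : ℤ) * ((if r' = 2 ∧ b' = 5 then (1 : ℤ) else 0) * phi (a - 2) 0 r b)
    + (5 : ℤ) * ((if r' = 2 ∧ 6 ≤ b' then (1 : ℤ) else 0) * phi (a - 2) 0 r b)
    + (6 : ℤ) * ((if r' = 2 ∧ b' = 2 then (1 : ℤ) else 0) * phi (a - 2) 1 r b)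
    + (if r' = 2 ∧ b' = 4 then (1 : ℤ) else 0) * phi (a - 2) 1 r b
    + (if r' = 2 ∧ b' = 5 then (1 : ℤ) else 0) * phi (a - 2) 1 r b
    + (if r' = 2 ∧ 6 ≤ b' then (1 : ℤ) else 0) * phi (a - 2) 1 r b
    + (6 : ℤ) * ((if r' = 2 ∧ b' = 1 then (1 : ℤ) else 0) * phi (a - 2) 2 r b)
    + (6 : ℤ) * ((if r' = 2 ∧ b' = 0 then (1 : ℤ) else 0) * phi (a - 2) 3 r b)
    + (if r' = 3 ∧ b' = 3 then (1 : ℤ) else 0) * phi (a - 3) 0 r b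
    + (if r' = 3 ∧ 6 ≤ b' then (1 : ℤ) else 0) * phi (a - 3) 0 r b
    + (5 : ℤ) * (phi (a - 3) 0 r b * phi 4 2 r' b')
    + phi (a - 3) 1 r b * ((if b' = 2 ∧ 6 ≤ r' then (1 : ℤ) else 0) - (if r' = 2 ∧ 6 ≤ b' then (1 : ℤ) else 0))
    + (4 : ℤ) * (phi (a - 3) 1 r b * ((if b' = 2 ∧ 3 ≤ r' then (1 : ℤ) else 0) - (if r' = 2 ∧ 3 ≤ b' then (1 : ℤ) else 0)))
    + (4 : ℤ) * ((if r' = 2 ∧ b' = 3 then (1 : ℤ) else 0) * phi (a - 3) 1 r b)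
    + (3 : ℤ) * ((if r' = 2 ∧ b' = 4 then (1 : ℤ) else 0) * phi (a - 3) 1 r b)
    + (3 : ℤ) * ((if r' = 2 ∧ b' = 5 then (1 : ℤ) else 0) * phi (a - 3) 1 r b)
    + (4 : ℤ) * ((if r' = 2 ∧ 6 ≤ b' then (1 : ℤ) else 0) * phi (a - 3) 1 r b)
    + (2 : ℤ) * ((if r' = 3 ∧ b' = 2 then (1 : ℤ) else 0) * phi (a - 3) 1 r b)
    + (if r' = 4 ∧ b' = 2 then (1 : ℤ) else 0) * phi (a - 3) 1 r b
    + (6 : ℤ) * ((if r' = 3 ∧ b' = 1 then (1 : ℤ) else 0) * phi (a - 3) 2 r b)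
    + (6 : ℤ) * ((if r' = 3 ∧ b' = 0 then (1 : ℤ) else 0) * phi (a - 3) 3 r b)
    + phi (a - 4) 0 r b * ((if b' = 3 ∧ 6 ≤ r' then (1 : ℤ) else 0) - (if r' = 3 ∧ 6 ≤ b' then (1 : ℤ) else 0))
    + (if r' = 4 ∧ b' = 3 then (1 : ℤ) else 0) * phi (a - 4) 0 r b
    + (if r' = 4 ∧ b' = 2 then (1 : ℤ) else 0) * phi (a - 4) 1 r b
    + (2 : ℤ) * (phi (a - 4) 2 r b * ((if b' = 1 ∧ 6 ≤ r' then (1 : ℤ) else 0) - (if r' = 1 ∧ 6 ≤ b' then (1 : ℤ) else 0)))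
    + (2 : ℤ) * ((if r' = 1 ∧ 6 ≤ b' then (1 : ℤ) else 0) * phi (a - 4) 2 r b)
    + (6 : ℤ) * ((if r' = 4 ∧ b' = 1 then (1 : ℤ) else 0) * phi (a - 4) 2 r b)
    + (6 : ℤ) * ((if r' = 4 ∧ b' = 0 then (1 : ℤ) else 0) * phi (a - 4) 3 r b)
    ≤ (6 : ℤ) * phi a 3 (r + r') (b + b') := by
  rcases (by omega : b = 0 ∨ b = 1 ∨ b = 2 ∨ b = 3 ∨ b = 4 ∨ b = 5 ∨ 6 ≤ b) with rfl | rfl | rfl | rfl | rfl | rfl | hb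
  · exact phi_col3_par_ge_b0 a r r' b' ha
  · exact phi_col3_par_ge_b1 a r r' b' ha
  · exact phi_col3_par_ge_b2 a r r' b' ha
  · exact phi_col3_par_ge_b3 a r r' b' ha
  · exact phi_col3_par_ge_b4 a r r' b' ha
  · exact phi_col3_par_ge_b5 a r r' b' ha
  · exact phi_col3_par_ge_bhi a r b r' b' ha hb

end Pointwise

end Summit.Ventures.PercRepro2.Tail2D
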